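import Summits.CriticalPhenomena.CardyFormulaZ2.Theorems.CardySelfDualSegmentUniformBoxCrossingStubSmallGapPart2
import HarnessLib

/-!
# Stub `stub_smallGap` (crux stmt-CriticalPhenomena-5476 `UniformBoxCrossing`, line `Sketch`):
# Bollobás–Riordan's Lemma 5.6 for the corner models `M_t`

Bollobás–Riordan, *Percolation on self-dual polygon configurations* (2010, arXiv:1001.4674),
§5.1, Lemma 5.6 ("this is the only place translational symmetry is used"), transplanted to
`M_t = cornerPercolation t` with the constants of line `Sketch`: base `k ≥ 1`, square side
`n = 32000 k`, vertical shift `s = k`, `N = 2M = 12000` stacked squares `S_j = [0,n]² + (0, j s)`,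
gap bound `G₀ = 360000 k²`. Either two consecutive squares are JOINED with probability
`≥ c₃ := 2^{-(N+2)}/N`, or the small-gap event `G_ε(S₁, S₂)` has probability `≥ c₃`
(`SmallGapStatement` of `…UniformBoxCrossingDefs2.lean`, consumed by `stub_assembly`).

Proof (B–R p. 21): `H := ⋂_{j ≤ N} H(S_j)` has `M_t(H) ≥ 2^{-(N+1)}` by Harris–FKG for `M_t`
(`cornerPercolation_real_inter_ge`; every square is crossed with probability `≥ 1/2`,
`cornerPercolation_real_lrCrossing_succ_self` + antitonicity) — `pow_le_real_stackedH`; if every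
`J(S_j, S_{j+1})` has probability `< c₃` then `M_t(H ∖ ⋃ J) ≥ 2^{-(N+2)}`, and on that event
(intersected with the `M_t`-sure lattice configurations) the deterministic Lemma 5.6 of part 2
(`exists_mem_smallGapEvent`) puts some frame into the small-gap event; the `N` frames are
translates of one another and `M_t` is translation invariant
(`cornerPercolation_real_preimage_relabel_shift`), whence the union bound gives
`N · M_t(G_ε) ≥ 2^{-(N+2)}`. Parts 1–2: `…StubSmallGapPart1.lean` (translates, frame identity,
monotonicity of the regions), `…StubSmallGapPart2.lean` (disjoint gaps, pigeonhole).
-/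

noncomputable section

namespace Summit.CriticalPhenomena.CardyFormulaZ2.Cruxes.UniformBoxCrossing.NonSlantLine

open MeasureTheory SimpleGraph Finset Literature.Probability.Percolation Literature.Probability.LatticeModels

/-! ### The translated events of the frames -/

section Frames

variable (t : unitInterval) (n s : ℕ)

/-- `H(S_j)`: the square `[0, n]² + (0, j s)` has an open left–right crossing (the crossing event
of `[0, n]²` for the configuration translated down by `j s`). [cite: BollobasRiordan2010, §5.1 Lemma 5.6] -/
def frameH (j : ℕ) : Set (BondConfig (Site 2)) := shiftDown (j * s) ⁻¹' lrCrossing n n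

/-- `J(S_j, S_{j+1})`: the JOIN event of frame `j`. [cite: BollobasRiordan2010, §5.1 Lemma 5.6] -/
def frameJ (j : ℕ) : Set (BondConfig (Site 2)) := shiftDown (j * s) ⁻¹' joinEvent n s

/-- `G_ε(S_j, S_{j+1})`: the small-gap event of frame `j`, gap bound `G₀`. [cite: BollobasRiordan2010, §5.1 Lemma 5.6] -/
def frameG (G₀ j : ℕ) : Set (BondConfig (Site 2)) := shiftDown (j * s) ⁻¹' smallGapEvent n s G₀

/-- `H(S_j)` is increasing. [folklore] -/
theorem isUpperSet_frameH (j : ℕ) : IsUpperSet (frameH n s j) := by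
  rw [frameH, shiftDown_eq]
  exact IsUpperSet.preimage_relabel _ (isUpperSet_lrCrossing n n)

/-- `H(S_j)` is measurable. [folklore] -/
theorem measurableSet_frameH (j : ℕ) : MeasurableSet (frameH n s j) := by
  rw [frameH, shiftDown_eq]
  exact (BondConfig.relabel _).measurable (measurableSet_lrCrossing n n)

/-- Translation invariance: `M_t(H(S_j)) = M_t(H([0,n]²))`. [folklore] -/
theorem real_frameH (j : ℕ) : (cornerPercolation t).real (frameH n s j) = (cornerPercolation t).real (lrCrossing n n) := by
  rw [frameH, shiftDown_eq]
  exact cornerPercolation_real_preimage_relabel_shift t _ _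

/-- Translation invariance: `M_t(J(S_j, S_{j+1})) = M_t(J(S₀, S₁))`. [folklore] -/
theorem real_frameJ (j : ℕ) : (cornerPercolation t).real (frameJ n s j) = (cornerPercolation t).real (joinEvent n s) := by
  rw [frameJ, shiftDown_eq]
  exact cornerPercolation_real_preimage_relabel_shift t _ _

/-- Translation invariance: `M_t(G_ε(S_j, S_{j+1})) = M_t(G_ε(S₀, S₁))`. [folklore] -/
theorem real_frameG (G₀ j : ℕ) :
    (cornerPercolation t).real (frameG n s G₀ j) = (cornerPercolation t).real (smallGapEvent n s G₀) := by
  rw [frameG, shiftDown_eq]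
  exact cornerPercolation_real_preimage_relabel_shift t _ _

/-- Squares are crossed horizontally with probability at least `1/2` under every `M_t`:
`1/2 = M_t(LR([0, n+1] × [0, n])) ≤ M_t(LR([0, n]²))`. [folklore] -/
private theorem half_le_real_lrCrossing_sq : 1 / 2 ≤ (cornerPercolation t).real (lrCrossing n n) := by
  -- adapted from `cornerPercolation_half_le_real_lrCrossing_self` (…StubBRChainPart1.lean)
  rw [← cornerPercolation_real_lrCrossing_succ_self t n]
  exact cornerPercolation_real_lrCrossing_anti_left t (Nat.le_succ n) n

/-- `⋂_{j < m} H(S_j)`: the first `m` squares of the stack are crossed horizontally. [cite: BollobasRiordan2010, §5.1 Lemma 5.6] -/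
def stackedH (m : ℕ) : Set (BondConfig (Site 2)) := ⋂ j ∈ Finset.range m, frameH n s j

/-- One more square. [folklore] -/
theorem stackedH_succ (m : ℕ) : stackedH n s (m + 1) = frameH n s m ∩ stackedH n s m := by
  rw [stackedH, stackedH, Finset.range_add_one, Finset.set_biInter_insert]

/-- `⋂ H(S_j)` is increasing. [folklore] -/
theorem isUpperSet_stackedH (m : ℕ) : IsUpperSet (stackedH n s m) :=
  isUpperSet_iInter₂ fun j _ => isUpperSet_frameH n s j

/-- `⋂ H(S_j)` is measurable. [folklore] -/
theorem measurableSet_stackedH (m : ℕ) : MeasurableSet (stackedH n s m) :=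
  Finset.measurableSet_biInter _ fun j _ => measurableSet_frameH n s j

/-- Membership in `⋂_{j < m} H(S_j)`. [folklore] -/
theorem mem_stackedH_iff {m : ℕ} {ω : BondConfig (Site 2)} :
    ω ∈ stackedH n s m ↔ ∀ j < m, shiftDown (j * s) ω ∈ lrCrossing n n := by
  simp only [stackedH, frameH, Set.mem_iInter, Set.mem_preimage, Finset.mem_range]

/-- **Harris–FKG for the stack**: `M_t(⋂_{j < m} H(S_j)) ≥ 2^{-m}` ("by Harris's Lemma we have
`P(H) ≥ ∏ P(H(S_i)) ≥ 2^{-(N+1)}`"). [cite: BollobasRiordan2010, §5.1 Lemma 5.6] -/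
theorem pow_le_real_stackedH (m : ℕ) : (1 / 2 : ℝ) ^ m ≤ (cornerPercolation t).real (stackedH n s m) := by
  induction m with
  | zero => simp [stackedH]
  | succ m ih =>
    rw [stackedH_succ, pow_succ]
    calc (1 / 2 : ℝ) ^ m * (1 / 2)
        ≤ (cornerPercolation t).real (stackedH n s m) * (cornerPercolation t).real (frameH n s m) :=
          mul_le_mul ih (by rw [real_frameH]; exact half_le_real_lrCrossing_sq t n) (by norm_num)
            measureReal_nonneg
      _ ≤ (cornerPercolation t).real (stackedH n s m ∩ frameH n s m) :=
          cornerPercolation_real_inter_ge t (isUpperSet_stackedH n s m) (isUpperSet_frameH n s m)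
            (measurableSet_stackedH n s m) (measurableSet_frameH n s m)
      _ = (cornerPercolation t).real (frameH n s m ∩ stackedH n s m) := by rw [Set.inter_comm]

end Frames

/-! ### Lemma 5.6 for `M_t` -/

section Lemma56

/-- **Bollobás–Riordan's Lemma 5.6 for `M_t`, general constants.** For `1 ≤ s ≤ n`, `M ≥ 1` and a
gap bound `G₀` with `#([0, n] × [0, n + 2Ms]) < M (G₀ + 1)`: with `c := 2^{-(2M+2)} / (2M)`,
either `M_t(J(S₀, S₁)) ≥ c` or `M_t(G(S₀, S₁; G₀)) ≥ c`, for every `t`.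
[cite: BollobasRiordan2010, §5.1 Lemma 5.6] -/
theorem smallGap_alternative (hcover : CoverStatement) (t : unitInterval) {n s M G₀ : ℕ} (hM : 1 ≤ M)
    (hs : 1 ≤ s) (hsn : s ≤ n) (hG : (rectangle n (n + 2 * M * s)).card < M * (G₀ + 1)) :
    (1 / 2 : ℝ) ^ (2 * M + 2) / (2 * (M : ℝ)) ≤ (cornerPercolation t).real (joinEvent n s) ∨
    (1 / 2 : ℝ) ^ (2 * M + 2) / (2 * (M : ℝ)) ≤ (cornerPercolation t).real (smallGapEvent n s G₀) := by
  classical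
  have hMpos : (0 : ℝ) < 2 * (M : ℝ) := by positivity
  have hcM : 2 * (M : ℝ) * ((1 / 2 : ℝ) ^ (2 * M + 2) / (2 * (M : ℝ))) = (1 / 2 : ℝ) ^ (2 * M + 2) := by
    field_simp
  by_cases hex : ∃ j < 2 * M, (1 / 2 : ℝ) ^ (2 * M + 2) / (2 * (M : ℝ)) ≤ (cornerPercolation t).real (frameJ n s j)
  · obtain ⟨j, -, hj⟩ := hex
    left
    rwa [real_frameJ] at hj
  right
  push Not at hex
  -- the good event: all squares crossed, no consecutive pair joined
  have hE : (1 / 2 : ℝ) ^ (2 * M + 1) ≤ (cornerPercolation t).real (stackedH n s (2 * M + 1)) :=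
    pow_le_real_stackedH t n s _
  have hU : (cornerPercolation t).real (⋃ j ∈ Finset.range (2 * M), frameJ n s j) ≤
      2 * (M : ℝ) * ((1 / 2 : ℝ) ^ (2 * M + 2) / (2 * (M : ℝ))) := by
    refine (measureReal_biUnion_finset_le _ _).trans ?_
    refine (Finset.sum_le_sum fun j hj => (hex j (Finset.mem_range.1 hj)).le).trans ?_
    rw [Finset.sum_const, Finset.card_range, nsmul_eq_mul]
    push_cast
    exact le_rfl
  have hEU : (cornerPercolation t).real (stackedH n s (2 * M + 1)) ≤
      (cornerPercolation t).real (stackedH n s (2 * M + 1) \ ⋃ j ∈ Finset.range (2 * M), frameJ n s j) +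
        (cornerPercolation t).real (⋃ j ∈ Finset.range (2 * M), frameJ n s j) := by
    refine (measureReal_mono ?_).trans (measureReal_union_le _ _)
    intro ω hω
    by_cases h : ω ∈ ⋃ j ∈ Finset.range (2 * M), frameJ n s j
    · exact Or.inr h
    · exact Or.inl ⟨hω, h⟩
  -- on the good event some frame is in the small-gap event (deterministic Lemma 5.6)
  have hV : (cornerPercolation t).real
        (stackedH n s (2 * M + 1) \ ⋃ j ∈ Finset.range (2 * M), frameJ n s j) ≤
      (cornerPercolation t).real (⋃ j ∈ Finset.range (2 * M), frameG n s G₀ j) := by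
    simp only [measureReal_def]
    refine ENNReal.toReal_mono (measure_ne_top _ _) (measure_mono_ae ?_)
    filter_upwards [cornerPercolation_subset_edgeSet t] with ω hω hmem
    obtain ⟨hωE, hωU⟩ := hmem
    rw [mem_stackedH_iff] at hωE
    have hH' : ∀ j ≤ 2 * M, shiftDown (j * s) ω ∈ lrCrossing n n := fun j hj => hωE j (by omega)
    have hJ' : ∀ j < 2 * M, shiftDown (j * s) ω ∉ joinEvent n s := fun j hj hωJ =>
      hωU (Set.mem_iUnion₂.2 ⟨j, Finset.mem_range.2 hj, hωJ⟩)
    obtain ⟨j, hj, hjG⟩ := exists_mem_smallGapEvent hcover hω hs hsn hH' hJ' hG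
    exact Set.mem_iUnion₂.2 ⟨j, Finset.mem_range.2 hj, hjG⟩
  have hVsum : (cornerPercolation t).real (⋃ j ∈ Finset.range (2 * M), frameG n s G₀ j) ≤
      2 * (M : ℝ) * (cornerPercolation t).real (smallGapEvent n s G₀) := by
    refine (measureReal_biUnion_finset_le _ _).trans ?_
    simp only [real_frameG, Finset.sum_const, Finset.card_range, nsmul_eq_mul]
    push_cast
    exact le_rfl
  have hp : (1 / 2 : ℝ) ^ (2 * M + 1) = 2 * (1 / 2 : ℝ) ^ (2 * M + 2) := by ring
  refine le_of_mul_le_mul_left ?_ hMpos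
  rw [hcM]
  linarith

/-- The arithmetic of the line's constants: `#([0, 32000k] × [0, 44000k]) < 6000 (360000 k² + 1)`. [folklore] -/
theorem rectangle_card_lt (k : ℕ) (hk : 1 ≤ k) :
    (rectangle (32000 * k) (32000 * k + 2 * 6000 * k)).card < 6000 * (360000 * k ^ 2 + 1) := by
  rw [card_rectangle]
  nlinarith [Nat.mul_le_mul hk hk, hk]

/-- **Stub `stub_smallGap`: Bollobás–Riordan's Lemma 5.6 for `M_t` with the constants of line
`Sketch`** (`n = 32000k`, `s = k`, `N = 12000`, `G₀ = 360000k²`, `c₃ = 2^{-12002}/12000`):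
uniformly in `t ∈ [0, 1]` and `k ≥ 1`, either the JOIN event of `[0,n]²` and `[0,n]² + (0,k)`
or their small-gap event has `M_t`-probability at least `c₃`. (`hexplore` is not needed: the
regions are canonical functions of the configuration.) [cite: BollobasRiordan2010, §5.1 Lemma 5.6] -/
theorem stub_smallGap (hcover : CoverStatement) (hexplore : BridgeStatement ∧ ExaminedStatement) :
    SmallGapStatement := by
  have _ := hexplore
  refine ⟨(1 / 2 : ℝ) ^ (2 * 6000 + 2) / (2 * ((6000 : ℕ) : ℝ)), by positivity, fun t k hk => ?_⟩
  exact smallGap_alternative hcover t (n := 32000 * k) (s := k) (M := 6000) (G₀ := 360000 * k ^ 2)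
    (by norm_num) hk (by omega) (rectangle_card_lt k hk)

end Lemma56

end Summit.CriticalPhenomena.CardyFormulaZ2.Cruxes.UniformBoxCrossing.NonSlantLine
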